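import Literature.NumberTheory.Automorphic.TateLocalFactors
import HarnessLib

/-!
# Tate's local `ε`-factor: `ε(0, χ, ψ) ≠ 0` is a corollary of `∃! (e, a)` (proved)

`TateLocalFactors` states the local theory of Tate's thesis through the predicate
`HasTateEpsilon ψ μ μ' χ e a` (`ε(s, χ, ψ) = e · q^{-as}` and the functional equation with
`γ = ε · L(1 - s, χ⁻¹) / L(s, χ)`) and the named facts `existsUnique_hasTateEpsilon`
(`∃! (e, a)`) and `hasTateEpsilon_ne_zero` (`e ≠ 0`), both after Tate 1950, §2.5
(Bushnell–Henniart 2006, §23.4–23.5). This file proves, by two lines of algebra, that the second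
is a consequence of the first, for every `ψ, μ, μ', χ`:

* `HasTateEpsilon.of_eq_zero`: with `e = 0` the monomial `e T^a = 0 ∈ ℂ(T)` does not see the
  exponent, so `HasTateEpsilon ψ μ μ' χ 0 a → HasTateEpsilon ψ μ μ' χ 0 a'`;
* `HasTateEpsilon.ne_zero_of_existsUnique`: hence uniqueness of the pair `(e, a)` forces `e ≠ 0`
  (were `(0, a)` a solution, `(0, a + 1)` would be another);
* `hasTateEpsilon_ne_zero_of_existsUnique_hasTateEpsilon`:
  `existsUnique_hasTateEpsilon ψ μ μ' χ → hasTateEpsilon_ne_zero`.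

So `hasTateEpsilon_ne_zero` is discharged the moment `existsUnique_hasTateEpsilon` is, and need
not be carried as independent debt. (The same observation for the Rankin–Selberg `ε`-factor of
pairs is `hasRSEpsilon_ne_zero_of_existsUnique_hasRSEpsilon` in `RankinSelbergLocalEpsilonProofs`.)
Theorems only; no definitions, no named facts (D-0026).

## References

* J. Tate, *Fourier analysis in number fields and Hecke's zeta-functions* (thesis, 1950), in
  Cassels–Fröhlich, *Algebraic Number Theory* (1967), §2.5. [Tate1950]
* C. J. Bushnell, G. Henniart, *The local Langlands conjecture for `GL(2)`*, Springer 2006,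
  §23.4–23.5. [BushnellHenniart2006]
-/

set_option autoImplicit false

open MeasureTheory

noncomputable section

namespace Literature.NumberTheory.Automorphic

section TateEpsilon

variable {F : Type*} [Field F] [ValuativeRel F] [TopologicalSpace F] [IsNonarchimedeanLocalField F]
  [MeasurableSpace F] {ψ : AddChar F Circle} {μ : Measure F} {μ' : Measure Fˣ} {χ : QuasiChar F}

/-- **With `e = 0` the exponent is invisible**: `HasTateEpsilon ψ μ μ' χ 0 a` implies
`HasTateEpsilon ψ μ μ' χ 0 a'` for every `a'` (both say that the functional equation holds with
`γ = 0 · T^a · L(1-s, χ⁻¹)/L(s, χ) = 0`). [folklore] -/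
theorem HasTateEpsilon.of_eq_zero {a : ℤ} (h : HasTateEpsilon ψ μ μ' χ 0 a) (a' : ℤ) :
    HasTateEpsilon ψ μ μ' χ 0 a' := by
  unfold HasTateEpsilon at h ⊢
  simp only [tateEpsilonRat, map_zero, zero_mul, zero_div] at h ⊢
  exact h

/-- **Uniqueness of Tate's monomial data `(e, a)` forces `ε(0, χ, ψ) ≠ 0`**: if the pair with
`HasTateEpsilon ψ μ μ' χ e a` is unique, every solution has `e ≠ 0` — were `(0, a)` a solution,
so would be `(0, a + 1)` (`HasTateEpsilon.of_eq_zero`). (Tate 1950, §2.5: `ε(s, χ, ψ) = e q^{-as}`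
with `e ≠ 0`; Bushnell–Henniart 2006, §23.5.) [cite: Tate1950, §2.5] -/
theorem HasTateEpsilon.ne_zero_of_existsUnique
    (hu : ∃! ea : ℂ × ℤ, HasTateEpsilon ψ μ μ' χ ea.1 ea.2) {e : ℂ} {a : ℤ}
    (h : HasTateEpsilon ψ μ μ' χ e a) : e ≠ 0 := by
  rintro rfl
  have h1 : ((0 : ℂ), a) = ((0 : ℂ), a + 1) :=
    hu.unique (y₁ := ((0 : ℂ), a)) (y₂ := ((0 : ℂ), a + 1)) h (h.of_eq_zero (a + 1))
  have h2 := congrArg Prod.snd h1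
  simp at h2

/-- **The named fact `hasTateEpsilon_ne_zero` is a corollary of the named fact
`existsUnique_hasTateEpsilon`** (both in `TateLocalFactors`; Tate 1950, §2.5), for every
`ψ, μ, μ', χ`: under the hypotheses of the former (`ψ` continuous non-trivial, `μ`, `μ'` Haar)
the latter delivers `∃! (e, a)`, and `HasTateEpsilon.ne_zero_of_existsUnique` concludes. [cite: Tate1950, §2.5] -/
theorem hasTateEpsilon_ne_zero_of_existsUnique_hasTateEpsilon
    (hu : existsUnique_hasTateEpsilon ψ μ μ' χ) :
    hasTateEpsilon_ne_zero (ψ := ψ) (μ := μ) (μ' := μ') (χ := χ) := by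
  unfold existsUnique_hasTateEpsilon at hu
  unfold hasTateEpsilon_ne_zero
  intro hψ _ _ e a h
  exact HasTateEpsilon.ne_zero_of_existsUnique (hu hψ) h

end TateEpsilon

end Literature.NumberTheory.Automorphic
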